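import Summits.KontsevichZagierPeriods.KontsevichZagierPeriods.Theses.HyperbolicBloch
import Literature.NumberTheory.Transcendental.KZHyperbolicLadder
import Summits.KontsevichZagierPeriods.KontsevichZagierPeriods.Theorems.HyperbolicBlochOffTetraSectorKernelGlue
import Summits.KontsevichZagierPeriods.KontsevichZagierPeriods.Theorems.HyperbolicBlochOffTetraSectorKernelStubRungOneStd
import Summits.KontsevichZagierPeriods.KontsevichZagierPeriods.Theorems.HyperbolicBlochOffTetraSectorKernelStubStdFlatten
import Summits.KontsevichZagierPeriods.KontsevichZagierPeriods.Theorems.HyperbolicBlochOffTetraSectorKernelStubArcWeierstrass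
import Summits.KontsevichZagierPeriods.KontsevichZagierPeriods.Theorems.HyperbolicBlochOffTetraSectorKernelStubDiscClass
import Summits.KontsevichZagierPeriods.KontsevichZagierPeriods.Theorems.HyperbolicBlochOffTetraSectorKernelStubCornerSimplexClass
import Summits.KontsevichZagierPeriods.KontsevichZagierPeriods.Theorems.HyperbolicBlochOffTetraSectorKernelStubBakerEnvelope

/-!
# The first open layer, named — crux `OffTetraSectorKernel` (stmt-KontsevichZagierPeriods-10557), line `odd-hyperbolic-ladder` (v7, lead c5)

**GLUING THE BLOCH–WIGNER SECTOR TO THE WEIGHT-ONE ENVELOPE IS EXACTLY ONE LINEAR-INDEPENDENCE STATEMENT.** The crux adjoins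
the tetrahedral value-relators (the Bloch–Wigner sector) to `KZ.relations`; skeleton v7 proved that the weight-one envelope
(hyperbolic lengths and areas, algebraic volumes, `π`-areas, rational representations of dimension `≤ 1`) meets `ker eval`
inside `relations` (Baker). This file isolates what the crux demands on the JOINT subgroup generated by the ideal-tetrahedron
representations and the envelope: `jointLayer_of_blochWignerLinIndep` — IF a `ℤ`-combination `Σ nᵢ vol T(zᵢ)` of
Bloch–Wigner volumes (`zᵢ ∈ ℚ̄ ∩ ℍ⁺`) that equals a weight-one period value `r + Σ cⱼ log uⱼ + Σ d_l arctan t_l` (real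
algebraic data) must vanish, THEN every element of the joint subgroup with value `0` lies in
`relations ⊔ closure (tetra value-relators)`. The hypothesis is a classical-looking open statement beyond Baker's theorem (it
contains "Catalan's constant `G = D(i)` is not in `ℚ̄ + Σ ℚ̄ log ℚ̄ + Σ ℚ̄ arctan ℚ̄`"); the proof splits a joint element as
(tetrahedral part) + (envelope part) (`AddSubgroup.closure_union`), reads the envelope part's value off its mixed normal form
(`env_nfD_of_mem_closure`, `env_eval_of_nfD`), spends the hypothesis once to make BOTH values vanish, and then the tetrahedral
part is an adjoined relator by definition while the envelope part is a relation by the envelope theorem (`stub_bakerEnvelope`).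

References: A. Baker, *Transcendental Number Theory* (1975), Thm. 2.1; M. Kontsevich, D. Zagier, *Periods* (2001), §1.2;
D. Zagier, *The dilogarithm function* (2007), §II.2 (Bloch–Wigner values at algebraic arguments).
-/

noncomputable section

open Set MeasureTheory
open Literature.NumberTheory.Transcendental
open Summit.KontsevichZagierPeriods.HurwitzMicroSectors.NormalFormPrinciple.PiBox.Dlog
  (exists_carrierA exists_ptCarrierA exists_angCarrier)

namespace Summit.KontsevichZagierPeriods.HyperbolicBloch.OffTetraSectorKernel

/-- **Elements of the subgroup generated by the ideal-tetrahedron representations are, modulo relations, `ℤ`-combinations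
of ONE admissible family** (closure induction; two representations on the same `T z` with integrand `t⁻³` are congruent).
[cite: KontsevichZagier2001, §1.2 rule (1)] -/
theorem tetraSpan_normalForm (T : ℂ → Set (Fin 3 → ℝ)) (ρ : ℂ → KZ.IntegralRep 3)
    (hρ : ∀ z, IsAlgebraic ℚ z → 0 < z.im → (ρ z).domain = T z ∧ EqOn (ρ z).integrand (fun p => 1 / p 2 ^ 3) (T z))
    {t : KZ.FormalRep}
    (ht : t ∈ AddSubgroup.closure {y : KZ.FormalRep | ∃ (z : ℂ) (r : KZ.IntegralRep 3), IsAlgebraic ℚ z ∧ 0 < z.im ∧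
        r.domain = T z ∧ EqOn r.integrand (fun p => 1 / p 2 ^ 3) (T z) ∧ y = KZ.of r}) :
    ∃ (k : ℕ) (z : Fin k → ℂ) (n : Fin k → ℤ), (∀ i, IsAlgebraic ℚ (z i)) ∧ (∀ i, 0 < (z i).im) ∧
      t - ∑ i, n i • KZ.of (ρ (z i)) ∈ KZ.relations := by
  classical
  induction ht using AddSubgroup.closure_induction with
  | mem y hy =>
    obtain ⟨z, r, hz, him, hrd, hri, rfl⟩ := hy
    refine ⟨1, ![z], ![1], fun i => by fin_cases i; simpa using hz, fun i => by fin_cases i; simpa using him, ?_⟩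
    rw [Fin.sum_univ_one]
    simp only [Matrix.cons_val_fin_one, one_smul]
    obtain ⟨hd, hi⟩ := hρ z hz him
    exact KZ.of_sub_of_mem_relations_of_eqOn (by rw [hd, hrd]) fun p hp => by
      rw [hri (hrd ▸ hp), hi (hrd ▸ hp)]
  | zero => exact ⟨0, Fin.elim0, Fin.elim0, fun i => i.elim0, fun i => i.elim0, by simp⟩
  | add y y' _ _ ih ih' =>
    obtain ⟨k, z, n, hz, him, h⟩ := ih
    obtain ⟨k', z', n', hz', him', h'⟩ := ih'
    refine ⟨k + k', Fin.append z z', Fin.append n n', fun i => ?_, fun i => ?_, ?_⟩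
    · refine Fin.addCases (fun i => ?_) (fun i => ?_) i <;> simp [hz, hz']
    · refine Fin.addCases (fun i => ?_) (fun i => ?_) i <;> simp [him, him']
    · have : y + y' - ∑ i, Fin.append n n' i • KZ.of (ρ (Fin.append z z' i)) =
          (y - ∑ i, n i • KZ.of (ρ (z i))) + (y' - ∑ i, n' i • KZ.of (ρ (z' i))) := by
        rw [Fin.sum_univ_add]
        simp only [Fin.append_left, Fin.append_right]
        abel
      rw [this]
      exact add_mem h h'
  | neg y _ ih =>
    obtain ⟨k, z, n, hz, him, h⟩ := ih
    refine ⟨k, z, fun i => -n i, hz, him, ?_⟩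
    have : -y - ∑ i, (-n i) • KZ.of (ρ (z i)) = -(y - ∑ i, n i • KZ.of (ρ (z i))) := by
      simp only [neg_smul, Finset.sum_neg_distrib]
      abel
    rw [this]
    exact neg_mem h

/-- **THE FIRST OPEN LAYER, NAMED.** For the standard ideal-tetrahedron family `T`: IF every `ℤ`-combination of Bloch–Wigner
volumes `Σ nᵢ ∫_{T zᵢ} t⁻³` (`zᵢ ∈ ℚ̄ ∩ ℍ⁺`) that is a weight-one period value `r + Σ cⱼ log uⱼ + Σ d_l arctan t_l`
(`r, uⱼ > 1, cⱼ, t_l ≥ 0, d_l` real algebraic) vanishes, THEN the crux holds on the JOINT subgroup generated by the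
ideal-tetrahedron representations and the weight-one envelope: every element of value `0` lies in
`relations ⊔ closure (tetrahedral value-relators)`. The hypothesis is spent exactly once, to split `eval = 0` into the
vanishing of the tetrahedral value (an adjoined relator by definition) and of the envelope value (a relation by the weight-one
envelope theorem `stub_bakerEnvelope`, i.e. by Baker). [cite: KontsevichZagier2001, §1.2 Conjecture 1] -/
theorem jointLayer_of_blochWignerLinIndep :
    ∀ (T : ℂ → Set (Fin 3 → ℝ)), (∀ z, T z = {p | 0 < p 1 ∧ z.re * p 1 < z.im * p 0 ∧ z.im * (p 0 - 1) < (z.re - 1) * p 1 ∧ 0 < p 2 ∧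
      0 < z.im * (p 0 ^ 2 + p 1 ^ 2 + p 2 ^ 2 - p 0) + (z.re - Complex.normSq z) * p 1}) →
    (∀ (k : ℕ) (z : Fin k → ℂ) (n : Fin k → ℤ), (∀ i, IsAlgebraic ℚ (z i)) → (∀ i, 0 < (z i).im) →
      (∃ (r : ℝ) (m : ℕ) (u c : Fin m → ℝ) (m' : ℕ) (t d : Fin m' → ℝ), IsAlgebraic ℚ r ∧ (∀ j, 1 < u j) ∧
        (∀ j, IsAlgebraic ℚ (u j)) ∧ (∀ j, IsAlgebraic ℚ (c j)) ∧ (∀ l, 0 ≤ t l) ∧ (∀ l, IsAlgebraic ℚ (t l)) ∧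
        (∀ l, IsAlgebraic ℚ (d l)) ∧
        ∑ i, (n i : ℝ) * (∫ p in T (z i), 1 / p 2 ^ 3) = r + ∑ j, c j * Real.log (u j) + ∑ l, d l * Real.arctan (t l)) →
      ∑ i, (n i : ℝ) * (∫ p in T (z i), 1 / p 2 ^ 3) = 0) →
    ∀ x ∈ AddSubgroup.closure {y : KZ.FormalRep | ∃ (z : ℂ) (r : KZ.IntegralRep 3), IsAlgebraic ℚ z ∧ 0 < z.im ∧
        r.domain = T z ∧ EqOn r.integrand (fun p => 1 / p 2 ^ 3) (T z) ∧ y = KZ.of r} ⊔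
      AddSubgroup.closure
        ({y : KZ.FormalRep | ∃ r : KZ.IntegralRep 1, KZ.IsGeodesicPolytope 0 r.domain ∧
            EqOn r.integrand (KZ.hypDensity 0) r.domain ∧ y = KZ.of r} ∪
          {y | ∃ r : KZ.IntegralRep 2, KZ.IsGeodesicPolytope 1 r.domain ∧
            EqOn r.integrand (KZ.hypDensity 1) r.domain ∧ y = KZ.of r} ∪
          {y | ∃ (d : ℕ) (A : Matrix (Fin d) (Fin d) ℝ) (b : Fin d → ℝ) (r : KZ.IntegralRep d),
            (∀ j l, IsAlgebraic ℚ (A j l)) ∧ (∀ j, IsAlgebraic ℚ (b j)) ∧ A.det ≠ 0 ∧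
            r.domain = (fun x => A.mulVec x + b) '' {x | (∀ i, 0 < x i) ∧ ∑ i, x i < 1} ∧
            (∀ x ∈ r.domain, r.integrand x = 1) ∧ y = KZ.of r} ∪
          {y | ∃ (A : Matrix (Fin 2) (Fin 2) ℝ) (b : Fin 2 → ℝ) (r : KZ.IntegralRep 2),
            (∀ j l, IsAlgebraic ℚ (A j l)) ∧ (∀ j, IsAlgebraic ℚ (b j)) ∧ A.det ≠ 0 ∧
            r.domain = (fun x => A.mulVec x + b) '' {p | p 0 ^ 2 + p 1 ^ 2 < 1} ∧
            (∀ x ∈ r.domain, r.integrand x = 1) ∧ y = KZ.of r} ∪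
          {y | ∃ (m : ℕ) (N : KZ.IntegralRep m), m ≤ 1 ∧ N.IsRational ∧ y = KZ.of N}),
      KZ.eval x = 0 → x ∈ KZ.relations ⊔ AddSubgroup.closure {d : KZ.FormalRep | ∃ ρ : ℂ → KZ.IntegralRep 3,
          (∀ z, IsAlgebraic ℚ z → 0 < z.im → (ρ z).domain = T z ∧
            Set.EqOn (ρ z).integrand (fun p => 1 / p 2 ^ 3) (T z)) ∧
          ∃ (k : ℕ) (z : Fin k → ℂ) (n : Fin k → ℤ), (∀ i, IsAlgebraic ℚ (z i)) ∧ (∀ i, 0 < (z i).im) ∧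
            ∑ i, (n i : ℝ) * (ρ (z i)).value = 0 ∧ d = ∑ i, n i • KZ.of (ρ (z i))} := by
  intro T hT hL x hx hv
  classical
  -- one admissible family on the `T z`
  obtain ⟨ρ, hρ0⟩ := exists_tetraFamily
  have hρ : ∀ z, IsAlgebraic ℚ z → 0 < z.im →
      (ρ z).domain = T z ∧ EqOn (ρ z).integrand (fun p => 1 / p 2 ^ 3) (T z) := by
    intro z hz him
    have hTz : T z = idealTetrahedron z := by rw [hT]; rfl
    rw [hTz]
    exact hρ0 z hz him
  -- split `x = t + g`
  obtain ⟨t, ht, g, hg, rfl⟩ := AddSubgroup.mem_sup.mp hx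
  obtain ⟨k, z, n, hz, him, htrel⟩ := tetraSpan_normalForm T ρ hρ ht
  -- the value of the tetrahedral part
  have hvol : ∀ i, (ρ (z i)).value = ∫ p in T (z i), 1 / p 2 ^ 3 := fun i => by
    obtain ⟨hd, hi⟩ := hρ (z i) (hz i) (him i)
    rw [KZ.IntegralRep.value, setIntegral_congr_fun (KZ.IntegralRep.measurableSet_domain_holds _)
      (fun p hp => hi (hd ▸ hp)), hd]
  have hevt : KZ.eval t = ∑ i, (n i : ℝ) * ∫ p in T (z i), 1 / p 2 ^ 3 := by
    have h0 := KZ.relations_le_ker_eval_holds htrel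
    rw [AddMonoidHom.mem_ker, map_sub, sub_eq_zero, map_sum] at h0
    rw [h0]
    exact Finset.sum_congr rfl fun i _ => by rw [map_zsmul, KZ.eval_of, hvol, zsmul_eq_mul]
  -- the value of the envelope part, off its mixed normal form
  obtain ⟨RA, hR⟩ := exists_carrierA
  obtain ⟨ZA, hZ⟩ := exists_ptCarrierA
  obtain ⟨RG, hRG⟩ := exists_angCarrier
  obtain ⟨r, m, u, c, m', tt, d, hr, hu1, hu, hc, ht0, htt, hd, hEq⟩ :=
    env_nfD_of_mem_closure hR hZ hRG stub_rungOneStd stub_stdFlatten stub_arcWeierstrass stub_cornerSimplexClass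
      stub_discClass hg
  have hevg : KZ.eval g = r + ∑ j, c j * Real.log (u j) + ∑ l, d l * Real.arctan (tt l) :=
    env_eval_of_nfD hR hZ hRG hr hu1 hu hc ht0 htt hd hEq
  -- spend the hypothesis: the tetrahedral value is a (negated) weight-one value, hence both vanish
  have hsum : ∑ i, (n i : ℝ) * (∫ p in T (z i), 1 / p 2 ^ 3) =
      -r + ∑ j, (-c j) * Real.log (u j) + ∑ l, (-d l) * Real.arctan (tt l) := by
    rw [map_add, hevt, hevg] at hv
    have : ∑ j, (-c j) * Real.log (u j) = -∑ j, c j * Real.log (u j) := by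
      rw [← Finset.sum_neg_distrib]; exact Finset.sum_congr rfl fun j _ => by ring
    have h' : ∑ l, (-d l) * Real.arctan (tt l) = -∑ l, d l * Real.arctan (tt l) := by
      rw [← Finset.sum_neg_distrib]; exact Finset.sum_congr rfl fun l _ => by ring
    rw [this, h']
    linarith
  have ht0v : ∑ i, (n i : ℝ) * (∫ p in T (z i), 1 / p 2 ^ 3) = 0 :=
    hL k z n hz him ⟨-r, m, u, fun j => -c j, m', tt, fun l => -d l, hr.neg, hu1, hu, fun j => (hc j).neg, ht0, htt,
      fun l => (hd l).neg, hsum⟩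
  have hgv : KZ.eval g = 0 := by
    rw [map_add, hevt, ht0v, zero_add] at hv
    exact hv
  -- conclude
  have hgrel : g ∈ KZ.relations :=
    stub_bakerEnvelope stub_rungOneStd stub_stdFlatten stub_arcWeierstrass stub_cornerSimplexClass stub_discClass g hg hgv
  have htmem : ∑ i, n i • KZ.of (ρ (z i)) ∈ AddSubgroup.closure {d : KZ.FormalRep | ∃ ρ : ℂ → KZ.IntegralRep 3,
      (∀ z, IsAlgebraic ℚ z → 0 < z.im → (ρ z).domain = T z ∧
        Set.EqOn (ρ z).integrand (fun p => 1 / p 2 ^ 3) (T z)) ∧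
      ∃ (k : ℕ) (z : Fin k → ℂ) (n : Fin k → ℤ), (∀ i, IsAlgebraic ℚ (z i)) ∧ (∀ i, 0 < (z i).im) ∧
        ∑ i, (n i : ℝ) * (ρ (z i)).value = 0 ∧ d = ∑ i, n i • KZ.of (ρ (z i))} :=
    AddSubgroup.subset_closure ⟨ρ, hρ, k, z, n, hz, him, by
      rw [← ht0v]; exact Finset.sum_congr rfl fun i _ => by rw [hvol], rfl⟩
  have : t + g = (t - ∑ i, n i • KZ.of (ρ (z i))) + g + ∑ i, n i • KZ.of (ρ (z i)) := by abel
  rw [this]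
  exact add_mem (AddSubgroup.mem_sup_left (add_mem htrel hgrel)) (AddSubgroup.mem_sup_right htmem)

end Summit.KontsevichZagierPeriods.HyperbolicBloch.OffTetraSectorKernel

end
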